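import Mathlib
import Literature.Computation.Certificates.LinearODETaylorStageSound
import HarnessLib

/-!
# Kernel-checkable analytic continuation of linear second-order ODEs, IV: chains and the transition matrix

Topic `Literature/Computation/Certificates` (namespace `Literature.Computation.Certificates.LinearODE`). Composition of
stages along a mesh `a = c₀, c₁ = c₀ + h₀, …, b`, transporting the 2×2 transition matrix with a certified error budget:
* `Acc` ⟨`c`, `P`, `E`⟩ and `Equation.accStep` — `P ↦ T·P` rounded to `2^{-G}ℤ` (`roundQ`), error bounds propagated by
  `errEntry` (`|T| E + τ (|P| + E)`) plus the exact rounding defect, rounded up (`roundUpQ`, `le_roundUpQ`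
  [cite: Moore1966, §3.2]); `chainCheckFrom`/`chainRun`; `centres`, `ChainCert` ⟨`eqn`, `a`, `G`, `stages`, `claim`⟩ with
  `lo`/`hi` and `check` (all stages check at their own centres and the run reproduces the claimed final state);
* `row_bound` (the real inequality of one bookkeeping row), `ChainInv`, `inv_step`, `inv_chain`;
* **`ChainCert.sound`** — `check = true` ⇒ for every `(y, y′)` solving the equation on an open `(α, β) ⊃ [lo, hi]`:
  `|y(b) − (Φ₀₀ y(a) + Φ₀₁ y′(a))| ≤ ε₀₀|y(a)| + ε₀₁|y′(a)|` and `|y′(b) − (Φ₁₀ y(a) + Φ₁₁ y′(a))| ≤ ε₁₀|y(a)| + ε₁₁|y′(a)|`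
  with `b, Φ, ε` the rational literals of `claim` — a VALIDATED FUNDAMENTAL MATRIX of the linear equation between `a` and
  `b`, replayable by `decide` [cite: Henrici1974, §3.6 eqs. (3.6-10)–(3.6-13)].
Existence of solutions is not part of the certificate (use `LinearSecondOrder.exists_solution_Ioi` or the client's own
construction); the certificate bounds EVERY solution. No axioms beyond the standard three, no `sorry`.

## References
* P. Henrici, *Applied and Computational Complex Analysis*, Vol. 1, Wiley 1974: §1.2 (formal power series, the division
  recursion (1.2-2)), §2.3 Lemma 2.3f (majorant of the reciprocal), §3.6 (numerical analytic continuation along an arc,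
  eqs. (3.6-10)–(3.6-13)). Key `Henrici1974`.
* E. A. Coddington, N. Levinson, *Theory of Ordinary Differential Equations*, McGraw–Hill 1955, Ch. 3 §8 (linear
  equations with analytic coefficients), Ch. 4 §3 (the majorant method). Key `CoddingtonLevinson1955`.
* P. Hartman, *Ordinary Differential Equations*, SIAM Classics 38 (2002), Ch. IV §1 Lemma 1.1 (uniqueness), §12 (12.12)
  (undetermined coefficients). Key `Hartman2002`.
* M. Neher, *Geometric series bounds for the local errors of Taylor methods for linear n-th order ODEs*, in
  Alefeld–Rohn–Rump–Yamamoto (eds.), Symbolic Algebraic Methods and Verification Methods, Springer 2001, 183–193.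
  Key `Neher2001`.
* M. Mezzarobba, *Truncation bounds for differentially finite series*, Ann. Henri Lebesgue 2 (2019) 99–148. Key
  `Mezzarobba2019`; *Rigorous multiple-precision evaluation of D-finite functions in SageMath*, ICMS 2016,
  arXiv:1607.01967. Key `Mezzarobba2016`.
* R. E. Moore, *Interval Analysis*, Prentice–Hall 1966, §3.2 (rounded rational arithmetic). Key `Moore1966`.

PRINTED PRIOR ART (certnum-lit-2, FRESHNESS §3.12): transport of a fundamental system with interval initial values along
the mesh is [cite: Neher2001, §4.2 (10)] (no Lohner coordinate change is needed here: the transported matrix is kept in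
exact/dyadic rationals and the defect is booked explicitly); transition matrices between expansion points in ball
arithmetic: [cite: Mezzarobba2016, §3–4]. New here: kernel replay (`decide`, one declaration per node).
-/

open Finset Polynomial Set
open Literature.Analysis.ODE

namespace Literature.Computation.Certificates

namespace LinearODE

/-! ### The chain: transporting the transition matrix with a certified error budget -/

/-- Upward rounding to the dyadic grid `2^{-G} ℤ`. [cite: Moore1966, §3.2 "rounded interval arithmetic"] -/
def roundUpQ (G : ℕ) (q : ℚ) : ℚ := (⌈q * 2 ^ G⌉ : ℚ) / 2 ^ G

/-- Nearest rounding to the dyadic grid `2^{-G} ℤ` (used for the transported matrix; its error is accounted for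
exactly, so no property of it is needed). [cite: Moore1966, §3.2 "rounded interval arithmetic"] -/
def roundQ (G : ℕ) (q : ℚ) : ℚ := (round (q * 2 ^ G) : ℚ) / 2 ^ G

/-- `q ≤ roundUpQ G q`. [cite: Moore1966, §3.2 "rounded interval arithmetic"] -/
theorem le_roundUpQ (G : ℕ) (q : ℚ) : q ≤ roundUpQ G q := by
  rw [roundUpQ, le_div_iff₀ (by positivity)]
  exact Int.le_ceil _

/-- The bookkeeping state of the chain: current centre `c`, transported matrix `P` (rows: `y`, `y′`; columns: the data
`y(a)`, `y′(a)`) and the error-bound matrix `E` (same layout): `|y(c) − (P₀₀ y(a) + P₀₁ y′(a))| ≤ E₀₀|y(a)| + E₀₁|y′(a)|`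
and the same for `y′(c)` with row `1`. [cite: Henrici1974, §3.6 eqs. (3.6-10)–(3.6-13)] -/
structure Acc where
  /-- current centre -/
  c : ℚ
  /-- transported matrix, rows `(P₀₀, P₀₁)`, `(P₁₀, P₁₁)` -/
  P : (ℚ × ℚ) × (ℚ × ℚ)
  /-- error bounds, rows `(E₀₀, E₀₁)`, `(E₁₀, E₁₁)` -/
  E : (ℚ × ℚ) × (ℚ × ℚ)
  deriving DecidableEq

/-- The initial state at `u = a`: identity matrix, zero error. [cite: Henrici1974, §3.6 eq. (3.6-10)] -/
def Acc.init (a : ℚ) : Acc := ⟨a, ((1, 0), (0, 1)), ((0, 0), (0, 0))⟩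

namespace Equation

variable (Eqn : Equation)

/-- The new error entry of one row/column before rounding:
`|T₀| E₀ⱼ + |T₁| E₁ⱼ + τ₁ (|P₀ⱼ| + E₀ⱼ) + τ₂ (|P₁ⱼ| + E₁ⱼ)`. [cite: Henrici1974, §3.6 eq. (3.6-13)] -/
def errEntry (T0 T1 τ1 τ2 P0j P1j E0j E1j : ℚ) : ℚ :=
  |T0| * E0j + |T1| * E1j + τ1 * (|P0j| + E0j) + τ2 * (|P1j| + E1j)

/-- **ONE STEP OF THE CHAIN BOOKKEEPING**: transport `P ↦ T P` (rounded to `2^{-G}ℤ`), propagate the error bounds and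
add the tail and rounding errors (rounded up). [cite: Henrici1974, §3.6 eqs. (3.6-10)–(3.6-13)] -/
def accStep (G : ℕ) (A : Acc) (st : Stage) : Acc :=
  let o := Eqn.stageOut A.c st
  let T00 := o.S1.1
  let T01 := o.S2.1
  let T10 := o.S1.2
  let T11 := o.S2.2
  let nP00 := T00 * A.P.1.1 + T01 * A.P.2.1
  let nP01 := T00 * A.P.1.2 + T01 * A.P.2.2
  let nP10 := T10 * A.P.1.1 + T11 * A.P.2.1
  let nP11 := T10 * A.P.1.2 + T11 * A.P.2.2
  let P00 := roundQ G nP00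
  let P01 := roundQ G nP01
  let P10 := roundQ G nP10
  let P11 := roundQ G nP11
  let E00 := roundUpQ G (errEntry T00 T01 o.τ1 o.τ2 A.P.1.1 A.P.2.1 A.E.1.1 A.E.2.1 + |nP00 - P00|)
  let E01 := roundUpQ G (errEntry T00 T01 o.τ1 o.τ2 A.P.1.2 A.P.2.2 A.E.1.2 A.E.2.2 + |nP01 - P01|)
  let E10 := roundUpQ G (errEntry T10 T11 o.τ1 o.τ2 A.P.1.1 A.P.2.1 A.E.1.1 A.E.2.1 + |nP10 - P10|)
  let E11 := roundUpQ G (errEntry T10 T11 o.τ1 o.τ2 A.P.1.2 A.P.2.2 A.E.1.2 A.E.2.2 + |nP11 - P11|)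
  ⟨A.c + st.h, ((P00, P01), (P10, P11)), ((E00, E01), (E10, E11))⟩

end Equation

/-- A node of a chain: the bookkeeping state AT the node (given as literals, so that the kernel checks every stage
independently) and the stage leaving it. [cite: Henrici1974, §3.6 eq. (3.6-13)] -/
structure Node where
  /-- the state `(c, P, E)` at this node -/
  acc : Acc
  /-- the stage from this node to the next -/
  st : Stage

/-- The state at the head of a node list (the claimed final state if the list is empty).
[cite: Henrici1974, §3.6 eq. (3.6-13)] -/
def nextAcc (final : Acc) : List Node → Acc
  | [] => final
  | n :: _ => n.acc

namespace Equation

variable (Eqn : Equation)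

/-- The check of ONE node against the next state: the stage checks at the node's centre and one bookkeeping step from
the node's literal state reproduces the next literal state. [cite: Henrici1974, §3.6 eq. (3.6-13)] -/
def nodeCheck (G : ℕ) (n : Node) (next : Acc) : Bool :=
  Eqn.stageCheck n.acc.c n.st && decide (Eqn.accStep G n.acc n.st = next)

/-- **THE CHAIN CHECKER** on a node list: every node checks against its successor (the final state after the last
node) — each node is an independent, linear-cost kernel computation (`chainCheckL_cons_of` assembles per-node facts
proved in separate declarations). [cite: Henrici1974, §3.6 eq. (3.6-13)] -/
def chainCheckL (G : ℕ) (final : Acc) : List Node → Bool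
  | [] => true
  | n :: rest => Eqn.nodeCheck G n (nextAcc final rest) && chainCheckL G final rest

/-- [cite: Henrici1974, §3.6 eq. (3.6-13)] -/
theorem chainCheckL_nil (G : ℕ) (final : Acc) : Eqn.chainCheckL G final [] = true := rfl

/-- Assembling the chain check from a node fact and the check of the rest. [cite: Henrici1974, §3.6 eq. (3.6-13)] -/
theorem chainCheckL_cons_of {G : ℕ} {final : Acc} {n : Node} {rest : List Node}
    (hn : Eqn.nodeCheck G n (nextAcc final rest) = true) (hr : Eqn.chainCheckL G final rest = true) :
    Eqn.chainCheckL G final (n :: rest) = true := by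
  rw [chainCheckL, hn, hr, Bool.and_self]

end Equation

/-- **A CHAIN CERTIFICATE**: the equation, the rounding parameter `G`, the nodes (literal states + stages, the first
node's state being the identity state at the starting point `a`) and the claimed FINAL state (centre `b`, matrix `Φ`,
error matrix `ε`). [cite: Henrici1974, §3.6 eqs. (3.6-10)–(3.6-13)] -/
structure ChainCert where
  /-- the equation `P₂ y″ + P₁ y′ + P₀ y = 0` -/
  eqn : Equation
  /-- dyadic precision of the bookkeeping -/
  G : ℕ
  /-- the nodes -/
  nodes : List Node
  /-- the claimed final state -/
  final : Acc

namespace ChainCert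

variable (C : ChainCert)

/-- The starting state (first node; the final state for an empty chain). [cite: Henrici1974, §3.6 eq. (3.6-10)] -/
def start : Acc := nextAcc C.final C.nodes
/-- The starting point `a`. [cite: Henrici1974, §3.6 eq. (3.6-10)] -/
def a : ℚ := C.start.c
/-- The endpoint `b`. [cite: Henrici1974, §3.6 eq. (3.6-10)] -/
def b : ℚ := C.final.c
/-- All centres (node centres and the endpoint). [cite: Henrici1974, §3.6 eq. (3.6-10)] -/
def centres : List ℚ := C.nodes.map (fun n => n.acc.c) ++ [C.final.c]
/-- Smallest centre. [cite: Henrici1974, §3.6 eq. (3.6-10)] -/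
def lo : ℚ := C.centres.foldr min C.final.c
/-- Largest centre. [cite: Henrici1974, §3.6 eq. (3.6-10)] -/
def hi : ℚ := C.centres.foldr max C.final.c

/-- **THE CERTIFICATE CHECKER**: the chain starts from the identity state (`Φ = 1`, `ε = 0`) and every node checks.
[cite: Henrici1974, §3.6 eqs. (3.6-10)–(3.6-13)] -/
def check : Bool :=
  decide (C.start.P = ((1, 0), (0, 1))) && decide (C.start.E = ((0, 0), (0, 0))) &&
    C.eqn.chainCheckL C.G C.final C.nodes

/-- Assembling `check` from the start conditions and the node-list check (the latter from per-node `decide`s via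
`chainCheckL_cons_of`). [cite: Henrici1974, §3.6 eq. (3.6-13)] -/
theorem check_of (hP : C.start.P = ((1, 0), (0, 1))) (hE : C.start.E = ((0, 0), (0, 0)))
    (h : C.eqn.chainCheckL C.G C.final C.nodes = true) : C.check = true := by
  simp [check, hP, hE, h]

end ChainCert

/-! ### Soundness of the chain -/

/-- The row inequality of the bookkeeping step (pure real arithmetic). [cite: Henrici1974, §3.6 eq. (3.6-13)] -/
theorem row_bound {yc yc' ynew s0 s1 T0 T1 τ1 τ2 P00 P01 P10 P11 E00 E01 E10 E11 P0' P1' E0' E1' : ℝ}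
    (hstage : |ynew - (yc * T0 + yc' * T1)| ≤ |yc| * τ1 + |yc'| * τ2)
    (h0 : |yc - (P00 * s0 + P01 * s1)| ≤ E00 * |s0| + E01 * |s1|)
    (h1 : |yc' - (P10 * s0 + P11 * s1)| ≤ E10 * |s0| + E11 * |s1|)
    (hτ1 : 0 ≤ τ1) (hτ2 : 0 ≤ τ2)
    (hE0 : |T0| * E00 + |T1| * E10 + τ1 * (|P00| + E00) + τ2 * (|P10| + E10) +
      |T0 * P00 + T1 * P10 - P0'| ≤ E0')
    (hE1 : |T0| * E01 + |T1| * E11 + τ1 * (|P01| + E01) + τ2 * (|P11| + E11) +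
      |T0 * P01 + T1 * P11 - P1'| ≤ E1') :
    |ynew - (P0' * s0 + P1' * s1)| ≤ E0' * |s0| + E1' * |s1| := by
  set d0 := yc - (P00 * s0 + P01 * s1) with hd0
  set d1 := yc' - (P10 * s0 + P11 * s1) with hd1
  set e := ynew - (yc * T0 + yc' * T1) with he
  have hs0 := abs_nonneg s0
  have hs1 := abs_nonneg s1
  have hyc : |yc| ≤ (|P00| + E00) * |s0| + (|P01| + E01) * |s1| := by
    have : yc = (P00 * s0 + P01 * s1) + d0 := by rw [hd0]; ring
    rw [this]
    calc |P00 * s0 + P01 * s1 + d0| ≤ |P00 * s0| + |P01 * s1| + |d0| := abs_add_three _ _ _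
      _ ≤ |P00| * |s0| + |P01| * |s1| + (E00 * |s0| + E01 * |s1|) := by
          rw [abs_mul, abs_mul]; linarith [h0]
      _ = (|P00| + E00) * |s0| + (|P01| + E01) * |s1| := by ring
  have hyc' : |yc'| ≤ (|P10| + E10) * |s0| + (|P11| + E11) * |s1| := by
    have : yc' = (P10 * s0 + P11 * s1) + d1 := by rw [hd1]; ring
    rw [this]
    calc |P10 * s0 + P11 * s1 + d1| ≤ |P10 * s0| + |P11 * s1| + |d1| := abs_add_three _ _ _
      _ ≤ |P10| * |s0| + |P11| * |s1| + (E10 * |s0| + E11 * |s1|) := by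
          rw [abs_mul, abs_mul]; linarith [h1]
      _ = (|P10| + E10) * |s0| + (|P11| + E11) * |s1| := by ring
  have hdecomp : ynew - (P0' * s0 + P1' * s1) =
      e + T0 * d0 + T1 * d1 + (T0 * P00 + T1 * P10 - P0') * s0 + (T0 * P01 + T1 * P11 - P1') * s1 := by
    rw [he, hd0, hd1]; ring
  rw [hdecomp]
  have he' : |e| ≤ τ1 * ((|P00| + E00) * |s0| + (|P01| + E01) * |s1|) +
      τ2 * ((|P10| + E10) * |s0| + (|P11| + E11) * |s1|) := by
    calc |e| ≤ |yc| * τ1 + |yc'| * τ2 := hstage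
      _ ≤ ((|P00| + E00) * |s0| + (|P01| + E01) * |s1|) * τ1 +
            ((|P10| + E10) * |s0| + (|P11| + E11) * |s1|) * τ2 :=
          add_le_add (mul_le_mul_of_nonneg_right hyc hτ1) (mul_le_mul_of_nonneg_right hyc' hτ2)
      _ = _ := by ring
  have hT0 : |T0 * d0| ≤ |T0| * (E00 * |s0| + E01 * |s1|) := by
    rw [abs_mul]; exact mul_le_mul_of_nonneg_left h0 (abs_nonneg _)
  have hT1 : |T1 * d1| ≤ |T1| * (E10 * |s0| + E11 * |s1|) := by
    rw [abs_mul]; exact mul_le_mul_of_nonneg_left h1 (abs_nonneg _)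
  have hr0 : |(T0 * P00 + T1 * P10 - P0') * s0| = |T0 * P00 + T1 * P10 - P0'| * |s0| := abs_mul _ _
  have hr1 : |(T0 * P01 + T1 * P11 - P1') * s1| = |T0 * P01 + T1 * P11 - P1'| * |s1| := abs_mul _ _
  have hE0' := mul_le_mul_of_nonneg_right hE0 hs0
  have hE1' := mul_le_mul_of_nonneg_right hE1 hs1
  calc |e + T0 * d0 + T1 * d1 + (T0 * P00 + T1 * P10 - P0') * s0 + (T0 * P01 + T1 * P11 - P1') * s1|
      ≤ |e| + |T0 * d0| + |T1 * d1| + |(T0 * P00 + T1 * P10 - P0') * s0| + |(T0 * P01 + T1 * P11 - P1') * s1| := by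
        have i1 := abs_add_le (e + T0 * d0 + T1 * d1 + (T0 * P00 + T1 * P10 - P0') * s0)
          ((T0 * P01 + T1 * P11 - P1') * s1)
        have i2 := abs_add_le (e + T0 * d0 + T1 * d1) ((T0 * P00 + T1 * P10 - P0') * s0)
        have i3 := abs_add_le (e + T0 * d0) (T1 * d1)
        have i4 := abs_add_le e (T0 * d0)
        linarith
    _ ≤ E0' * |s0| + E1' * |s1| := by
        rw [hr0, hr1]
        nlinarith [he', hT0, hT1, hE0', hE1', hs0, hs1, abs_nonneg T0, abs_nonneg T1]

namespace Equation

variable (Eqn : Equation)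

/-- The invariant of the chain for a given solution with data `(s₀, s₁) = (y(a), y′(a))`.
[cite: Henrici1974, §3.6 eq. (3.6-13)] -/
def ChainInv (y y' : ℝ → ℝ) (s0 s1 : ℝ) (A : Acc) : Prop :=
  |y A.c - (A.P.1.1 * s0 + A.P.1.2 * s1)| ≤ A.E.1.1 * |s0| + A.E.1.2 * |s1| ∧
    |y' A.c - (A.P.2.1 * s0 + A.P.2.2 * s1)| ≤ A.E.2.1 * |s0| + A.E.2.2 * |s1|

/-- The invariant holds at a state with `P = 1`, `E = 0` for the data read off at its centre.
[cite: Henrici1974, §3.6 eq. (3.6-10)] -/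
theorem inv_start (y y' : ℝ → ℝ) {A : Acc} (hP : A.P = ((1, 0), (0, 1))) (hE : A.E = ((0, 0), (0, 0))) :
    ChainInv y y' (y A.c) (y' A.c) A := by
  constructor <;> simp [hP, hE]

/-- Nonnegativity of the tail bounds of a checked stage. [cite: CoddingtonLevinson1955, Ch. 4 §3] -/
theorem τ_nonneg {c : ℚ} {st : Stage} (hc : Eqn.stageCheck c st = true) :
    0 ≤ (Eqn.stageOut c st).τ1 ∧ 0 ≤ (Eqn.stageOut c st).τ2 := by
  simp only [stageCheck, Bool.and_eq_true, decide_eq_true_eq] at hc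
  obtain ⟨⟨⟨⟨⟨⟨⟨⟨-, -⟩, hρ⟩, -⟩, hμ⟩, -⟩, -⟩, hμh⟩, -⟩ := hc
  have hμ0 : 0 < st.mu := lt_trans (inv_pos.2 hρ) hμ
  have ht : 0 ≤ (st.mu * |st.h|) ^ st.N / (1 - st.mu * |st.h|) :=
    div_nonneg (pow_nonneg (mul_nonneg hμ0.le (abs_nonneg _)) _) (by linarith)
  exact ⟨mul_nonneg (bmaxQ_nonneg _ hμ0 _) ht, mul_nonneg (bmaxQ_nonneg _ hμ0 _) ht⟩

/-- **THE BOOKKEEPING STEP PRESERVES THE INVARIANT.** [cite: Henrici1974, §3.6 eq. (3.6-13)] -/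
theorem inv_step {G : ℕ} {A : Acc} {st : Stage} (hc : Eqn.stageCheck A.c st = true) {α β : ℝ} {y y' : ℝ → ℝ}
    (hy : Eqn.IsSolOn y y' (Ioo α β)) (hcJ : (A.c : ℝ) ∈ Ioo α β) (hchJ : ((A.c + st.h : ℚ) : ℝ) ∈ Ioo α β)
    {s0 s1 : ℝ} (hI : ChainInv y y' s0 s1 A) : ChainInv y y' s0 s1 (Eqn.accStep G A st) := by
  obtain ⟨hst1, hst2⟩ := Eqn.stage_sound hc hy hcJ hchJ
  obtain ⟨hτ1, hτ2⟩ := Eqn.τ_nonneg hc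
  obtain ⟨h0, h1⟩ := hI
  have hτ1R : (0 : ℝ) ≤ (Eqn.stageOut A.c st).τ1 := by exact_mod_cast hτ1
  have hτ2R : (0 : ℝ) ≤ (Eqn.stageOut A.c st).τ2 := by exact_mod_cast hτ2
  constructor
  · refine row_bound hst1 h0 h1 hτ1R hτ2R ?_ ?_ <;>
    · simp only [accStep, errEntry]
      refine le_trans (le_of_eq ?_) (Rat.cast_le.2 (le_roundUpQ _ _))
      push_cast
      ring
  · refine row_bound hst2 h0 h1 hτ1R hτ2R ?_ ?_ <;>
    · simp only [accStep, errEntry]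
      refine le_trans (le_of_eq ?_) (Rat.cast_le.2 (le_roundUpQ _ _))
      push_cast
      ring

/-- **INDUCTION ALONG THE NODES**: if the node list checks, all its centres and the endpoint lie in the interval, and
the invariant holds at the head state, then it holds at the final state. [cite: Henrici1974, §3.6 eq. (3.6-13)] -/
theorem inv_chain (G : ℕ) (final : Acc) {α β : ℝ} {y y' : ℝ → ℝ} (hy : Eqn.IsSolOn y y' (Ioo α β))
    (hfin : (final.c : ℝ) ∈ Ioo α β) {s0 s1 : ℝ} :
    ∀ (nodes : List Node), Eqn.chainCheckL G final nodes = true →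
      (∀ n ∈ nodes, (n.acc.c : ℝ) ∈ Ioo α β) → ChainInv y y' s0 s1 (nextAcc final nodes) →
        ChainInv y y' s0 s1 final
  | [], _, _, hI => hI
  | n :: rest, hc, hJ, hI => by
    simp only [chainCheckL, nodeCheck, Bool.and_eq_true, decide_eq_true_eq] at hc
    obtain ⟨⟨hst, hnext⟩, hrest⟩ := hc
    have hcJ : (n.acc.c : ℝ) ∈ Ioo α β := hJ n (by simp)
    have hJ' : ∀ n' ∈ rest, (n'.acc.c : ℝ) ∈ Ioo α β := fun n' hn' => hJ n' (by simp [hn'])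
    have hc' : (nextAcc final rest).c = n.acc.c + n.st.h := by rw [← hnext]; rfl
    have hchJ : ((n.acc.c + n.st.h : ℚ) : ℝ) ∈ Ioo α β := by
      rw [← hc']
      cases rest with
      | nil => exact hfin
      | cons n' r' => exact hJ' n' (by simp)
    have hstep := Eqn.inv_step (G := G) hst hy hcJ hchJ hI
    rw [hnext] at hstep
    exact inv_chain G final hy hfin rest hrest hJ' hstep

end Equation

namespace ChainCert

variable (C : ChainCert)

/-- Every centre lies between `lo` and `hi`. [cite: Henrici1974, §3.6 eq. (3.6-10)] -/
theorem lo_le_hi_of_mem : ∀ q ∈ C.centres, C.lo ≤ q ∧ q ≤ C.hi := by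
  intro q hq
  simp only [lo, hi]
  generalize C.centres = l at hq ⊢
  induction l with
  | nil => exact absurd hq List.not_mem_nil
  | cons x t ih =>
    simp only [List.foldr_cons]
    rcases List.mem_cons.1 hq with rfl | h
    · exact ⟨min_le_left _ _, le_max_left _ _⟩
    · obtain ⟨h1, h2⟩ := ih h
      exact ⟨(min_le_right _ _).trans h1, h2.trans (le_max_right _ _)⟩

/-- **SOUNDNESS OF THE CHAIN CERTIFICATE (validated fundamental matrix, uniqueness form).** If `C.check = true` and
`(y, y′)` solves `P₂ y″ + P₁ y′ + P₀ y = 0` on an open interval `(α, β) ⊃ [lo, hi]`, then with `a = C.a`, `b = C.b`,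
`Φ = C.final.P`, `ε = C.final.E`:
`|y(b) − (Φ₀₀ y(a) + Φ₀₁ y′(a))| ≤ ε₀₀ |y(a)| + ε₀₁ |y′(a)|` and
`|y′(b) − (Φ₁₀ y(a) + Φ₁₁ y′(a))| ≤ ε₁₀ |y(a)| + ε₁₁ |y′(a)|` — the transition matrix of the linear equation from `a`
to `b` within the printed rational error matrix, for EVERY solution; replayable by the Lean kernel (`decide`).
[cite: Henrici1974, §3.6 eqs. (3.6-10)–(3.6-13)] [cite: CoddingtonLevinson1955, Ch. 3 §8 and Ch. 4 §3] -/
theorem sound (hC : C.check = true) {α β : ℝ} {y y' : ℝ → ℝ} (hy : C.eqn.IsSolOn y y' (Ioo α β))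
    (hlo : α < C.lo) (hhi : (C.hi : ℝ) < β) :
    |y C.b - (C.final.P.1.1 * y C.a + C.final.P.1.2 * y' C.a)| ≤
        C.final.E.1.1 * |y C.a| + C.final.E.1.2 * |y' C.a| ∧
      |y' C.b - (C.final.P.2.1 * y C.a + C.final.P.2.2 * y' C.a)| ≤
        C.final.E.2.1 * |y C.a| + C.final.E.2.2 * |y' C.a| := by
  simp only [check, Bool.and_eq_true, decide_eq_true_eq] at hC
  obtain ⟨⟨hP, hE⟩, hrun⟩ := hC
  have hJ : ∀ q ∈ C.centres, (q : ℝ) ∈ Ioo α β := fun q hq => by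
    obtain ⟨h1, h2⟩ := C.lo_le_hi_of_mem q hq
    exact ⟨lt_of_lt_of_le hlo (by exact_mod_cast h1), lt_of_le_of_lt (by exact_mod_cast h2) hhi⟩
  have hfin : (C.final.c : ℝ) ∈ Ioo α β := hJ _ (by simp [centres])
  have hnodes : ∀ n ∈ C.nodes, (n.acc.c : ℝ) ∈ Ioo α β := fun n hn =>
    hJ _ (by simp only [centres, List.mem_append, List.mem_map]; exact Or.inl ⟨n, hn, rfl⟩)
  exact C.eqn.inv_chain C.G C.final hy hfin C.nodes hrun hnodes (Equation.inv_start y y' hP hE)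

end ChainCert

end LinearODE

end Literature.Computation.Certificates
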